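import Literature.AlgebraicGeometry.Resolution.PlanePointBlowupAmbient
import Literature.AlgebraicGeometry.Resolution.BlowupsLocal
import Literature.AlgebraicGeometry.Resolution.BlowupsEquivariant
import Literature.AlgebraicGeometry.Resolution.NormalCrossingsLocal
import HarnessLib

/-!
# Blowing up a point that has a PLANE CHART: the blow-up is smooth over `K` — every field `K`

Topic: `Literature/AlgebraicGeometry/Resolution`. Companion of `PlanePointBlowupAmbient.lean` (the blow-up of the plane
`𝔸²_K` at the origin is covered by two affine planes, hence smooth over EVERY field `K`). Here the statement is
LOCALISED: let `f : Z → Spec K` be any smooth morphism and `ξ ∈ Z` a closed point admitting a PLANE CHART over `K`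
(`HasPlaneChart f ξ`: an open `V ∋ ξ` and an isomorphism `e : V ≅ 𝔸²_K` OVER `K` sending `ξ` to the origin). Then for
EVERY blowing up `π : W → Z` along the reduced ideal `𝓘_{ξ}`:

* `isBlowup_restrict_comp_chart` — over the chart, `π` IS (up to `e`) a blowing up of `𝔸²_K` at the origin
  (tree `IsBlowup.restrict` + `IsBlowup.comp_iso`; the ideal sheaves match by `comap_vanishingIdeal_of_isOpenImmersion`
  and `vanishingIdeal_comap_hom`);
* `smooth_comp_of_hasPlaneChart` — **`W → Spec K` is SMOOTH** (Mathlib: `Smooth` is Zariski-local at the source; over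
  the chart use `PlanePointBlowupAmbient.smooth_comp`, off `ξ` the blow-up is an isomorphism, tree
  `IsBlowup.isIso_compl`);
* `vanishingIdeal_singleton_ne_bot_of_hasPlaneChart`, `irreducibleSpace_of_hasPlaneChart`, `quasiCompact_comp` —
  `𝓘_{ξ} ≠ 0`, `W` irreducible (for `Z` integral), `W → Spec K` quasi-compact;
* `hasPlaneChart_ξ` — the origin of `𝔸²_K` itself has the tautological plane chart.

WHY (cell res-hironaka, LADDER-RESOLUTION rung L, slot W4.6): this is the AMBIENT half of the induction step that climbs
the cusp staircase `(𝔸²_K, ((y^p + xⁿ), p))` over an ARBITRARY field `K` (every later centre is the origin of an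
affine-plane chart of the previous blow-up); the chart-transfer half (the new singular point again has a plane chart)
is the companion `PlanePointBlowupChartTransfer.lean`. No perfectness of `K` anywhere.

## References

* The Stacks Project, Tags 0804, 02OS (blow-ups; isomorphism off the centre). [cite: StacksProject, Tag 0804]
* U. Görtz, T. Wedhorn, *Algebraic Geometry I* (2nd ed. 2020), Prop. 13.91 (blow-ups and flat/open base change).
  [cite: GortzWedhorn2020, Prop. 13.91]
* A. Grothendieck, EGA IV₄ (1967), Prop. 17.5.8 (iii). [Grothendieck1967]
-/

noncomputable section

set_option backward.isDefEq.respectTransparency false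

open CategoryTheory AlgebraicGeometry TopologicalSpace Opposite

namespace Literature.AlgebraicGeometry.Resolution

namespace PlanePointBlowup

open Scheme.IdealSheafData

universe u

variable {K : Type u} [Field K]

/-! ## Plane charts -/

/-- **A PLANE CHART of `f : Z → Spec K` at `ξ`**: an open `V ∋ ξ` of `Z` with an isomorphism `e : V ≅ 𝔸²_K = P K`
OVER `K` (`e ≫ (𝔸²_K → Spec K) = V ↪ Z → Spec K`) sending `ξ` to the origin `ξ K` (an «affine-plane neighbourhood», the
local model of a smooth surface point with a rational chart). [cite: GortzWedhorn2020, Prop. 13.91] -/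
def HasPlaneChart {Z : Scheme.{u}} (f : Z ⟶ Spec (.of K)) (x₀ : Z) : Prop :=
  ∃ (V : Z.Opens) (hx₀ : x₀ ∈ V) (e : (V : Scheme.{u}) ≅ P K),
    e.hom ≫ PlanePointBlowup.f K = V.ι ≫ f ∧ e.hom.base ⟨x₀, hx₀⟩ = ξ K

variable (K) in
/-- The origin of the plane has the tautological plane chart `V = ⊤`. [cite: StacksProject, Tag 01HR] -/
theorem hasPlaneChart_ξ : HasPlaneChart (PlanePointBlowup.f K) (ξ K) :=
  ⟨⊤, trivial, (P K).topIso, by rw [Scheme.topIso_hom], rfl⟩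

/-! ## The blow-up over a plane chart -/

section Chart

variable {Z : Scheme.{u}} {f : Z ⟶ Spec (.of K)} {x₀ : Z} {V : Z.Opens} {W : Scheme.{u}} {π : W ⟶ Z}

/-- Moving `𝓘_{ξ}` to the chart: `e_* (𝓘_{x₀}|_V) = 𝓘_{origin}` on `𝔸²_K`. [cite: GortzWedhorn2020, Prop. 13.91] -/
theorem comap_comap_vanishingIdeal_singleton_eq (hx₀ : IsClosed ({x₀} : Set Z)) (hx₀V : x₀ ∈ V)
    (e : (V : Scheme.{u}) ≅ P K) (hex₀ : e.hom.base ⟨x₀, hx₀V⟩ = ξ K) :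
    ((vanishingIdeal (⟨{x₀}, hx₀⟩ : Closeds Z)).comap V.ι).comap e.inv = 𝓘 K := by
  rw [comap_vanishingIdeal_of_isOpenImmersion V.ι]
  have h := vanishingIdeal_comap_hom e.symm ((⟨{x₀}, hx₀⟩ : Closeds Z).preimage V.ι.continuous)
  rw [Iso.symm_hom] at h
  rw [h, 𝓘, C₀]
  congr 1
  apply Closeds.ext
  simp only [Closeds.coe_preimage, Closeds.coe_mk]
  ext z
  simp only [Set.mem_preimage, Set.mem_singleton_iff, Scheme.Opens.ι_apply]
  constructor
  · intro hz
    have h1 : e.inv.base z = ⟨x₀, hx₀V⟩ := Subtype.ext hz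
    have h2 : e.hom.base (e.inv.base z) = z := by
      rw [← Scheme.Hom.comp_apply, Iso.inv_hom_id]
      rfl
    rw [← h2, h1, hex₀]
  · rintro rfl
    have h2 : e.inv.base (e.hom.base ⟨x₀, hx₀V⟩) = ⟨x₀, hx₀V⟩ := by
      rw [← Scheme.Hom.comp_apply, Iso.hom_inv_id]
      rfl
    rw [← hex₀, h2]

/-- **Over a plane chart the blow-up of `x₀` is a blow-up of `𝔸²_K` at the origin**: `(π|_V) ≫ e` is a blowing up of
`P K` along `𝓘_{origin}`. [cite: GortzWedhorn2020, Prop. 13.91] -/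
theorem isBlowup_restrict_comp_chart (hx₀ : IsClosed ({x₀} : Set Z)) (hx₀V : x₀ ∈ V)
    (e : (V : Scheme.{u}) ≅ P K) (hex₀ : e.hom.base ⟨x₀, hx₀V⟩ = ξ K)
    (hπ : IsBlowup π (vanishingIdeal (⟨{x₀}, hx₀⟩ : Closeds Z))) : IsBlowup ((π ∣_ V) ≫ e.hom) (𝓘 K) := by
  have h := (hπ.restrict V).comp_iso e
  rwa [comap_comap_vanishingIdeal_singleton_eq hx₀ hx₀V e hex₀] at h

/-- The two opens `π⁻¹(V)` and `π⁻¹(Z ∖ {x₀})` cover `W`. [cite: StacksProject, Tag 02OS] -/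
theorem preimage_sup_preimage_compl_eq_top (hx₀ : IsClosed ({x₀} : Set Z)) (hx₀V : x₀ ∈ V) :
    π ⁻¹ᵁ V ⊔ π ⁻¹ᵁ ⟨((vanishingIdeal (⟨{x₀}, hx₀⟩ : Closeds Z)).support : Set Z)ᶜ,
      (vanishingIdeal (⟨{x₀}, hx₀⟩ : Closeds Z)).support.isClosed.isOpen_compl⟩ = ⊤ := by
  apply le_antisymm le_top
  intro x _
  by_cases hx : π.base x = x₀
  · left
    show π.base x ∈ (V : Set Z)
    rw [hx]; exact hx₀V
  · right
    show π.base x ∈ ((vanishingIdeal (⟨{x₀}, hx₀⟩ : Closeds Z)).support : Set Z)ᶜ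
    rw [Scheme.IdealSheafData.coe_support_vanishingIdeal]
    exact hx

/-- **The blow-up of a point with a plane chart is SMOOTH over `K`** — every field `K`: over the chart it is the blown-up
plane (`PlanePointBlowupAmbient.smooth_comp`), off the point it is an isomorphism onto an open of the smooth `Z`.
[cite: GortzWedhorn2020, Prop. 13.91] -/
theorem smooth_comp_of_chart [Smooth f] (hx₀ : IsClosed ({x₀} : Set Z)) (hx₀V : x₀ ∈ V)
    (e : (V : Scheme.{u}) ≅ P K) (he : e.hom ≫ PlanePointBlowup.f K = V.ι ≫ f) (hex₀ : e.hom.base ⟨x₀, hx₀V⟩ = ξ K)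
    (hπ : IsBlowup π (vanishingIdeal (⟨{x₀}, hx₀⟩ : Closeds Z))) : Smooth (π ≫ f) := by
  let Vc : Z.Opens := ⟨((vanishingIdeal (⟨{x₀}, hx₀⟩ : Closeds Z)).support : Set Z)ᶜ,
    (vanishingIdeal (⟨{x₀}, hx₀⟩ : Closeds Z)).support.isClosed.isOpen_compl⟩
  refine IsZariskiLocalAtSource.of_iSup_eq_top (P := @Smooth) (fun b : Bool => bif b then π ⁻¹ᵁ V else π ⁻¹ᵁ Vc)
    ?_ fun b => ?_
  · rw [← preimage_sup_preimage_compl_eq_top hx₀ hx₀V (π := π)]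
    apply le_antisymm
    · refine iSup_le fun b => ?_
      cases b
      · exact le_sup_right
      · exact le_sup_left
    · exact sup_le (le_iSup (fun b : Bool => bif b then π ⁻¹ᵁ V else π ⁻¹ᵁ Vc) true)
        (le_iSup (fun b : Bool => bif b then π ⁻¹ᵁ V else π ⁻¹ᵁ Vc) false)
  · cases b with
    | true =>
      -- over the chart: the blown-up plane
      show Smooth ((π ⁻¹ᵁ V).ι ≫ π ≫ f)
      have hb := isBlowup_restrict_comp_chart hx₀ hx₀V e hex₀ hπ
      haveI := smooth_comp hb
      have heq : (π ⁻¹ᵁ V).ι ≫ π ≫ f = ((π ∣_ V) ≫ e.hom) ≫ PlanePointBlowup.f K := by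
        rw [Category.assoc, he, ← Category.assoc, ← morphismRestrict_ι, Category.assoc]
      rw [heq]
      infer_instance
    | false =>
      -- off the point: an isomorphism onto an open of `Z`
      show Smooth ((π ⁻¹ᵁ Vc).ι ≫ π ≫ f)
      haveI : IsIso (π ∣_ Vc) := hπ.isIso_compl
      have heq : (π ⁻¹ᵁ Vc).ι ≫ π ≫ f = (π ∣_ Vc) ≫ Vc.ι ≫ f := by
        rw [← Category.assoc, ← morphismRestrict_ι, Category.assoc]
      rw [heq]
      infer_instance

/-- **`𝓘_{x₀} ≠ 0` at a point with a plane chart.** [cite: StacksProject, Tag 01HR] -/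
theorem vanishingIdeal_singleton_ne_bot_of_chart (hx₀ : IsClosed ({x₀} : Set Z)) (hx₀V : x₀ ∈ V)
    (e : (V : Scheme.{u}) ≅ P K) (hex₀ : e.hom.base ⟨x₀, hx₀V⟩ = ξ K) :
    vanishingIdeal (⟨{x₀}, hx₀⟩ : Closeds Z) ≠ ⊥ := by
  intro h
  have h2 := comap_comap_vanishingIdeal_singleton_eq hx₀ hx₀V e hex₀
  rw [h, Scheme.IdealSheafData.comap_bot, Scheme.IdealSheafData.comap_bot] at h2
  exact 𝓘_ne_bot K h2.symm

end Chart

/-! ## Packaged over `HasPlaneChart` -/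

section Packaged

variable {Z : Scheme.{u}} {f : Z ⟶ Spec (.of K)} {x₀ : Z} {W : Scheme.{u}} {π : W ⟶ Z}

/-- **The blow-up of a point with a plane chart is SMOOTH over `K`** (every field `K`). [cite: GortzWedhorn2020, Prop. 13.91] -/
theorem smooth_comp_of_hasPlaneChart [Smooth f] (hx₀ : IsClosed ({x₀} : Set Z)) (hc : HasPlaneChart f x₀)
    (hπ : IsBlowup π (vanishingIdeal (⟨{x₀}, hx₀⟩ : Closeds Z))) : Smooth (π ≫ f) := by
  obtain ⟨V, hx₀V, e, he, hex₀⟩ := hc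
  exact smooth_comp_of_chart hx₀ hx₀V e he hex₀ hπ

/-- `𝓘_{x₀} ≠ 0` at a point with a plane chart. [cite: StacksProject, Tag 01HR] -/
theorem vanishingIdeal_singleton_ne_bot_of_hasPlaneChart (hx₀ : IsClosed ({x₀} : Set Z)) (hc : HasPlaneChart f x₀) :
    vanishingIdeal (⟨{x₀}, hx₀⟩ : Closeds Z) ≠ ⊥ := by
  obtain ⟨V, hx₀V, e, -, hex₀⟩ := hc
  exact vanishingIdeal_singleton_ne_bot_of_chart hx₀ hx₀V e hex₀

/-- The blow-up of an integral scheme at a point with a plane chart is irreducible. [cite: StacksProject, Tag 02ND] -/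
theorem irreducibleSpace_of_hasPlaneChart [IsIntegral Z] (hx₀ : IsClosed ({x₀} : Set Z)) (hc : HasPlaneChart f x₀)
    (hπ : IsBlowup π (vanishingIdeal (⟨{x₀}, hx₀⟩ : Closeds Z))) : IrreducibleSpace W :=
  hπ.irreducibleSpace (vanishingIdeal_singleton_ne_bot_of_hasPlaneChart hx₀ hc)

/-- The blow-up of an integral scheme at a point with a plane chart is integral. [cite: StacksProject, Tag 02ND] -/
theorem isIntegral_of_hasPlaneChart [IsIntegral Z] (hx₀ : IsClosed ({x₀} : Set Z)) (hc : HasPlaneChart f x₀)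
    (hπ : IsBlowup π (vanishingIdeal (⟨{x₀}, hx₀⟩ : Closeds Z))) : IsIntegral W :=
  hπ.isIntegral (vanishingIdeal_singleton_ne_bot_of_hasPlaneChart hx₀ hc)

/-- `W → Spec K` is quasi-compact (the blowing up is proper). [cite: StacksProject, Tag 02NS] -/
theorem quasiCompact_comp_of_isBlowup [IsLocallyNoetherian Z] [QuasiCompact f] {I : Z.IdealSheafData}
    (hπ : IsBlowup π I) : QuasiCompact (π ≫ f) := by
  haveI : IsProper π := hπ.isProper
  infer_instance

end Packaged

end PlanePointBlowup

end Literature.AlgebraicGeometry.Resolution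

end
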